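import Literature.Analysis.FluidPDE.TaoY6Cutoffs
import Mathlib.MeasureTheory.Integral.Bochner.Set
import Mathlib.MeasureTheory.Measure.Haar.InnerProductSpace
import Mathlib.Topology.MetricSpace.Thickening
import HarnessLib

/-!
# Bookkeeping for the dyadic shells: partition of unity, bounded overlap, layers

Analysis/FluidPDE support file for the discharge of the named fact
`Literature.Analysis.FluidPDE.tao2011_nonlinearEstimate` (Tao 2011, §10, proof of Thm. 10.1,
estimate of `Y₆`, arXiv:1108.1165 p. 32: "a boundedly overlapping collection of balls" and the
repeated use of "(10.20) and the bounded overlap of the `Bᵢ`" to resum local quantities into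
`∫|∇ω|²η` and `W`). For the smooth dyadic shells `χₙ = shellCutoff φ (σ₀/2ⁿ)` of
`FluidPDE/TaoY6Cutoffs` attached to a `1`-Lipschitz depth coordinate `φ` we prove:

* `sum_range_shellCutoff_eq` / `coreCutoff_add_sum_eq`: the shells telescope, and core + inner
  shells + outer shells up to generation `M` equals the core cutoff at slope `2ᴹ k`
  (a `[0,1]`-valued function equal to `1` at depth `≥ 2⁻ᴹ/k`);
* `sum_range_shellCutoff_le_indicator`: `Σₙ χₙ ≤ 1_{0 < φ < σ₀}` (the shells live in the layer);
* bounded overlap (`card_filter_le_three`, `sum_setIntegral_le_three_mul_integral`): a point lies in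
  at most three of the sets `{c₁ σ₀2⁻ⁿ ≤ φ ≤ c₂ σ₀2⁻ⁿ}` when `c₂ < 8c₁`, hence
  `Σₙ ∫_{Eₙ} G ≤ 3 ∫ G` for `G ≥ 0` and any sets `Eₙ` contained in them — applied to the supports
  of the shells (`c₁ = 1/4`, `c₂ = 1`) and to their closed `2rₙ`-neighbourhoods
  (`rₙ = σₙ/128`: `c₁ = 15/64`, `c₂ = 65/64`).

## References

* T. Tao, arXiv:1108.1165 (`Tao2011`), §10, proof of Thm. 10.1, p. 32.
-/

noncomputable section

open MeasureTheory Set Filter Metric Function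
open scoped NNReal

namespace Literature.Analysis.FluidPDE.TaoY6

/-! ### Bounded overlap of dyadic conditions -/

/-- A finite set of naturals any two of whose elements differ by at most `2` has at most three
elements. [folklore] -/
theorem card_filter_le_three {p : ℕ → Prop} [DecidablePred p]
    (h : ∀ m n, p m → p n → n ≤ m + 2) (M : ℕ) : ((Finset.range M).filter p).card ≤ 3 := by
  set T := (Finset.range M).filter p with hT
  rcases T.eq_empty_or_nonempty with h0 | hne
  · rw [h0]; simp
  · set m := T.min' hne with hm
    have hmT : m ∈ T := Finset.min'_mem T hne
    have hpm : p m := (Finset.mem_filter.1 hmT).2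
    have hsub : T ⊆ Finset.Icc m (m + 2) := by
      intro n hn
      rw [Finset.mem_Icc]
      exact ⟨Finset.min'_le T n hn, h m n hpm (Finset.mem_filter.1 hn).2⟩
    calc T.card ≤ (Finset.Icc m (m + 2)).card := Finset.card_le_card hsub
      _ = 3 := by rw [Nat.card_Icc]; omega

/-- **Dyadic conditions overlap at most thrice**: for `0 < c₁`, `c₂ < 8 c₁`, `σ₀ > 0` and any real
`d`, at most three `n` satisfy `c₁ σ₀/2ⁿ ≤ d ≤ c₂ σ₀/2ⁿ`. [folklore] -/
theorem dyadic_overlap_le_two {c₁ c₂ σ₀ d : ℝ} (hc₁ : 0 < c₁) (hc : c₂ < 8 * c₁) (hσ₀ : 0 < σ₀)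
    (m n : ℕ) (hm : c₁ * (σ₀ / 2 ^ m) ≤ d ∧ d ≤ c₂ * (σ₀ / 2 ^ m))
    (hn : c₁ * (σ₀ / 2 ^ n) ≤ d ∧ d ≤ c₂ * (σ₀ / 2 ^ n)) : n ≤ m + 2 := by
  by_contra hlt
  rw [not_le] at hlt
  have h1 : c₁ * (σ₀ / 2 ^ m) ≤ c₂ * (σ₀ / 2 ^ n) := hm.1.trans hn.2
  -- `2^n ≥ 8 · 2^m`
  have h2 : (8 : ℝ) * 2 ^ m ≤ 2 ^ n := by
    have : m + 3 ≤ n := hlt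
    calc (8 : ℝ) * 2 ^ m = 2 ^ (m + 3) := by rw [pow_add]; norm_num; ring
      _ ≤ 2 ^ n := pow_le_pow_right₀ (by norm_num) this
  have h3 : (0 : ℝ) < 2 ^ m := by positivity
  have h4 : (0 : ℝ) < 2 ^ n := by positivity
  rw [mul_div_assoc', mul_div_assoc', div_le_div_iff₀ h3 h4] at h1
  -- `c₁ σ₀ 2^n ≤ c₂ σ₀ 2^m < 8 c₁ σ₀ 2^m ≤ c₁ σ₀ 2^n`
  have h5 : c₂ * σ₀ * 2 ^ m < 8 * c₁ * σ₀ * 2 ^ m := by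
    have := mul_lt_mul_of_pos_right hc (mul_pos hσ₀ h3)
    nlinarith
  nlinarith [mul_le_mul_of_nonneg_left h2 (mul_pos hc₁ hσ₀).le]

/-- The number of `n < M` with `c₁ σ₀/2ⁿ ≤ d ≤ c₂ σ₀/2ⁿ` is at most `3` (`c₂ < 8c₁`). [folklore] -/
theorem card_filter_dyadic_le_three {c₁ c₂ σ₀ : ℝ} (hc₁ : 0 < c₁) (hc : c₂ < 8 * c₁) (hσ₀ : 0 < σ₀)
    (d : ℝ) (M : ℕ) :
    ((Finset.range M).filter fun n => c₁ * (σ₀ / 2 ^ n) ≤ d ∧ d ≤ c₂ * (σ₀ / 2 ^ n)).card ≤ 3 := by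
  classical
  exact card_filter_le_three (fun m n hm hn => dyadic_overlap_le_two hc₁ hc hσ₀ m n hm hn) M

section Overlap

variable {E : Type*} [MeasurableSpace E] {μ : Measure E}

/-- **Bounded overlap ⇒ resummation**: if the sets `Eₙ` are such that every point belongs to at
most `3` of them (witnessed by dyadic conditions on a function `φ`), then for `G ≥ 0` integrable,
`Σ_{n<M} ∫_{Eₙ} G ≤ 3 ∫ G`. [cite: Tao2011, §10, proof of Thm. 10.1 (p. 32, bounded overlap)] -/
theorem sum_setIntegral_le_three_mul_integral {φ : E → ℝ} {c₁ c₂ σ₀ : ℝ} (hc₁ : 0 < c₁)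
    (hc : c₂ < 8 * c₁) (hσ₀ : 0 < σ₀) {S : ℕ → Set E} (hS : ∀ n, MeasurableSet (S n))
    (hSφ : ∀ n, ∀ y ∈ S n, c₁ * (σ₀ / 2 ^ n) ≤ φ y ∧ φ y ≤ c₂ * (σ₀ / 2 ^ n))
    {G : E → ℝ} (hG0 : ∀ y, 0 ≤ G y) (hG : Integrable G μ) (M : ℕ) :
    ∑ n ∈ Finset.range M, ∫ y in S n, G y ∂μ ≤ 3 * ∫ y, G y ∂μ := by
  classical
  have h1 : ∀ n, ∫ y in S n, G y ∂μ = ∫ y, (S n).indicator G y ∂μ := fun n =>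
    (integral_indicator (hS n)).symm
  simp_rw [h1]
  rw [← integral_finsetSum _ fun n _ => hG.indicator (hS n), ← integral_const_mul]
  refine integral_mono_of_nonneg (Eventually.of_forall fun y => Finset.sum_nonneg fun n _ =>
    indicator_nonneg (fun y _ => hG0 y) y) (hG.const_mul 3) (Eventually.of_forall fun y => ?_)
  dsimp only
  have hpt : ∀ n, (S n).indicator G y = if y ∈ S n then G y else 0 := fun n => rfl
  simp_rw [hpt]
  rw [Finset.sum_ite, Finset.sum_const_zero, add_zero, Finset.sum_const, nsmul_eq_mul]
  refine mul_le_mul_of_nonneg_right ?_ (hG0 y)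
  have hsub : (Finset.range M).filter (fun n => y ∈ S n) ⊆
      (Finset.range M).filter fun n => c₁ * (σ₀ / 2 ^ n) ≤ φ y ∧ φ y ≤ c₂ * (σ₀ / 2 ^ n) := by
    intro n hn
    rw [Finset.mem_filter] at hn ⊢
    exact ⟨hn.1, hSφ n y hn.2⟩
  calc (((Finset.range M).filter fun n => y ∈ S n).card : ℝ)
      ≤ ((Finset.range M).filter fun n => c₁ * (σ₀ / 2 ^ n) ≤ φ y ∧ φ y ≤ c₂ * (σ₀ / 2 ^ n)).card := by
        exact_mod_cast Finset.card_le_card hsub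
    _ ≤ 3 := by exact_mod_cast card_filter_dyadic_le_three hc₁ hc hσ₀ (φ y) M

end Overlap

/-! ### The shells of a `1`-Lipschitz depth coordinate: supports and neighbourhoods -/

section ShellSets

variable {φ : EuclideanSpace ℝ (Fin 3) → ℝ} {σ₀ : ℝ}

/-- The support of the `n`-th shell lies in `{σₙ/4 ≤ φ ≤ σₙ}`, `σₙ = σ₀/2ⁿ`. [folklore] -/
theorem mem_tsupport_shellCutoff_bounds (hσ₀ : 0 < σ₀) (hφ : Continuous φ) (n : ℕ)
    {y : EuclideanSpace ℝ (Fin 3)} (hy : y ∈ tsupport (shellCutoff φ (σ₀ / 2 ^ n))) :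
    1 / 4 * (σ₀ / 2 ^ n) ≤ φ y ∧ φ y ≤ 1 * (σ₀ / 2 ^ n) := by
  have h := le_and_le_of_mem_tsupport_shellCutoff (by positivity : 0 < σ₀ / 2 ^ n) hφ hy
  constructor <;> linarith [h.1, h.2]

/-- The closed `2rₙ`-neighbourhood (`rₙ = σₙ/128`) of the (compact) support of the `n`-th shell
lies in `{(15/64) σₙ ≤ φ ≤ (65/64) σₙ}` when `φ` is `1`-Lipschitz. [folklore] -/
theorem mem_cthickening_tsupport_shellCutoff_bounds (hσ₀ : 0 < σ₀) (hφ : LipschitzWith 1 φ) (n : ℕ)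
    (hSc : IsCompact (tsupport (shellCutoff φ (σ₀ / 2 ^ n)))) {x : EuclideanSpace ℝ (Fin 3)}
    (hx : x ∈ cthickening (2 * (σ₀ / 2 ^ n / 128)) (tsupport (shellCutoff φ (σ₀ / 2 ^ n)))) :
    15 / 64 * (σ₀ / 2 ^ n) ≤ φ x ∧ φ x ≤ 65 / 64 * (σ₀ / 2 ^ n) := by
  have hσ : 0 < σ₀ / 2 ^ n := by positivity
  rw [hSc.cthickening_eq_biUnion_closedBall (by positivity)] at hx
  obtain ⟨y, hy, hxy⟩ := mem_iUnion₂.1 hx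
  rw [mem_closedBall] at hxy
  obtain ⟨h1, h2⟩ := le_and_le_of_mem_tsupport_shellCutoff hσ hφ.continuous hy
  have hlip := hφ.dist_le_mul x y
  rw [NNReal.coe_one, one_mul, Real.dist_eq] at hlip
  have habs := abs_le.1 (hlip.trans hxy)
  constructor <;> linarith [habs.1, habs.2]

/-- The shells have compact support as soon as they are supported in a fixed compact set; here is
the measurability we need. [folklore] -/
theorem measurableSet_tsupport_shellCutoff (φ : EuclideanSpace ℝ (Fin 3) → ℝ) (σ : ℝ) :
    MeasurableSet (tsupport (shellCutoff φ σ)) :=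
  (isClosed_tsupport _).measurableSet

/-- **Resummation over the supports of the shells**: `Σ_{n<M} ∫_{supp χₙ} G ≤ 3 ∫ G` for `G ≥ 0`
integrable. [cite: Tao2011, §10, proof of Thm. 10.1 (p. 32, bounded overlap)] -/
theorem sum_setIntegral_tsupport_shellCutoff_le (hσ₀ : 0 < σ₀) (hφ : Continuous φ)
    {G : EuclideanSpace ℝ (Fin 3) → ℝ} (hG0 : ∀ y, 0 ≤ G y) (hG : Integrable G) (M : ℕ) :
    ∑ n ∈ Finset.range M, ∫ y in tsupport (shellCutoff φ (σ₀ / 2 ^ n)), G y ≤ 3 * ∫ y, G y :=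
  sum_setIntegral_le_three_mul_integral (φ := φ) (c₁ := 1 / 4) (c₂ := 1) (by norm_num) (by norm_num)
    hσ₀ (fun n => measurableSet_tsupport_shellCutoff φ _)
    (fun n y hy => mem_tsupport_shellCutoff_bounds hσ₀ hφ n hy) hG0 hG M

/-- **Resummation over the `2rₙ`-neighbourhoods of the shells**: `Σ_{n<M} ∫_{Nₙ} G ≤ 3 ∫ G` for
`G ≥ 0` integrable (`φ` `1`-Lipschitz, shells compactly supported). [cite: Tao2011, §10, proof of Thm. 10.1 (p. 32, bounded overlap)] -/
theorem sum_setIntegral_cthickening_shellCutoff_le (hσ₀ : 0 < σ₀) (hφ : LipschitzWith 1 φ)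
    (hSc : ∀ n, IsCompact (tsupport (shellCutoff φ (σ₀ / 2 ^ n))))
    {G : EuclideanSpace ℝ (Fin 3) → ℝ} (hG0 : ∀ y, 0 ≤ G y) (hG : Integrable G) (M : ℕ) :
    ∑ n ∈ Finset.range M, ∫ y in cthickening (2 * (σ₀ / 2 ^ n / 128))
      (tsupport (shellCutoff φ (σ₀ / 2 ^ n))), G y ≤ 3 * ∫ y, G y :=
  sum_setIntegral_le_three_mul_integral (φ := φ) (c₁ := 15 / 64) (c₂ := 65 / 64) (by norm_num)
    (by norm_num) hσ₀ (fun n => isClosed_cthickening.measurableSet)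
    (fun n x hx => mem_cthickening_tsupport_shellCutoff_bounds hσ₀ hφ n (hSc n) hx) hG0 hG M

/-! ### The telescoping sums -/

/-- The shells telescope: `Σ_{n<M} χₙ(y) = ψ(2ᴹ φ(y)/σ₀) − ψ(φ(y)/σ₀)`. [folklore] -/
theorem sum_range_shellCutoff_eq (σ₀ : ℝ) (y : EuclideanSpace ℝ (Fin 3)) (M : ℕ) :
    ∑ n ∈ Finset.range M, shellCutoff φ (σ₀ / 2 ^ n) y =
      stepFun (2 ^ M * φ y / σ₀) - stepFun (φ y / σ₀) := by
  simp only [shellCutoff_apply]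
  exact sum_range_shellFun σ₀ (φ y) M

/-- `0 ≤ Σ_{n<M} χₙ ≤ 1`. [folklore] -/
theorem sum_range_shellCutoff_mem_Icc (hσ₀ : 0 < σ₀) (y : EuclideanSpace ℝ (Fin 3)) (M : ℕ) :
    ∑ n ∈ Finset.range M, shellCutoff φ (σ₀ / 2 ^ n) y ∈ Icc (0 : ℝ) 1 := by
  simp only [shellCutoff_apply]
  exact sum_range_shellFun_mem_Icc hσ₀ (φ y) M

/-- The shells live in the layer `{0 < φ < σ₀}`: `Σ_{n<M} χₙ ≤ 1_{0 < φ < σ₀}`. [folklore] -/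
theorem sum_range_shellCutoff_le_indicator (hσ₀ : 0 < σ₀) (y : EuclideanSpace ℝ (Fin 3)) (M : ℕ) :
    ∑ n ∈ Finset.range M, shellCutoff φ (σ₀ / 2 ^ n) y ≤
      {z : EuclideanSpace ℝ (Fin 3) | 0 < φ z ∧ φ z < σ₀}.indicator (fun _ => (1 : ℝ)) y := by
  by_cases hy : y ∈ {z : EuclideanSpace ℝ (Fin 3) | 0 < φ z ∧ φ z < σ₀}
  · rw [indicator_of_mem hy]
    exact (sum_range_shellCutoff_mem_Icc hσ₀ y M).2
  · rw [indicator_of_notMem hy]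
    simp only [mem_setOf_eq, not_and_or, not_lt] at hy
    simp only [shellCutoff_apply]
    rw [sum_range_shellFun_eq_zero hσ₀ hy M]

end ShellSets

/-! ### The full partition: core + inner shells + outer shells -/

section Partition

variable {x₀ : EuclideanSpace ℝ (Fin 3)} {k a b : ℝ}

/-- **Core + shells = core at slope `2ᴹk`**:
`χ_core + Σ_{n<M} (χₙⁱⁿ + χₙᵒᵘᵗ) = coreCutoff x₀ (2ᴹk) a b` pointwise (also for `k = 0`, by the junk
value `x / 0 = 0`). [folklore] -/
theorem coreCutoff_add_sum_eq (y : EuclideanSpace ℝ (Fin 3)) (M : ℕ) :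
    coreCutoff x₀ k a b y +
      (∑ n ∈ Finset.range M, shellCutoff (fun z : EuclideanSpace ℝ (Fin 3) => ‖z - x₀‖ - a)
        (k⁻¹ / 2 ^ n) y +
       ∑ n ∈ Finset.range M, shellCutoff (fun z : EuclideanSpace ℝ (Fin 3) => b - ‖z - x₀‖)
        (k⁻¹ / 2 ^ n) y) = coreCutoff x₀ (2 ^ M * k) a b y := by
  rw [sum_range_shellCutoff_eq, sum_range_shellCutoff_eq, coreCutoff_apply, coreCutoff_apply]
  have e1 : ∀ t : ℝ, 2 ^ M * t / k⁻¹ = 2 ^ M * k * t := fun t => by rw [div_inv_eq_mul]; ring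
  have e2 : ∀ t : ℝ, t / k⁻¹ = k * t := fun t => by rw [div_inv_eq_mul, mul_comm]
  rw [e1, e1, e2, e2]
  ring

/-- The partial partition of unity takes values in `[0, 1]` (under `a + 2/k ≤ b`). [folklore] -/
theorem coreCutoff_pow_mul_mem_Icc (hk : 0 < k) (hab : a + 2 / k ≤ b) (y : EuclideanSpace ℝ (Fin 3))
    (M : ℕ) : coreCutoff x₀ (2 ^ M * k) a b y ∈ Icc (0 : ℝ) 1 := by
  refine coreCutoff_mem_Icc (by positivity) (le_trans ?_ hab) y
  have h1 : (1 : ℝ) ≤ 2 ^ M := one_le_pow₀ (by norm_num)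
  have : 2 / (2 ^ M * k) ≤ 2 / k := by
    rw [div_le_div_iff₀ (by positivity) hk]
    nlinarith
  linarith

/-- The partial partition of unity equals `1` at points of the annulus of depth at least
`2⁻ᴹ/k` in both directions. [folklore] -/
theorem coreCutoff_pow_mul_eq_one (hk : 0 < k) {y : EuclideanSpace ℝ (Fin 3)} {M : ℕ}
    (h₁ : 1 / (2 ^ M * k) ≤ ‖y - x₀‖ - a) (h₂ : 1 / (2 ^ M * k) ≤ b - ‖y - x₀‖) :
    coreCutoff x₀ (2 ^ M * k) a b y = 1 :=
  coreCutoff_eq_one (mul_pos (pow_pos two_pos M) hk) h₁ h₂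

/-- At every point of the open annulus the partial partition of unity is eventually `1`.
[folklore] -/
theorem eventually_coreCutoff_pow_mul_eq_one (hk : 0 < k) {y : EuclideanSpace ℝ (Fin 3)}
    (hya : a < ‖y - x₀‖) (hyb : ‖y - x₀‖ < b) :
    ∀ᶠ M : ℕ in atTop, coreCutoff x₀ (2 ^ M * k) a b y = 1 := by
  -- `1/(2ᴹ k) → 0`
  have hd : 0 < min (‖y - x₀‖ - a) (b - ‖y - x₀‖) := lt_min (by linarith) (by linarith)
  have hlim : Tendsto (fun M : ℕ => 1 / (2 ^ M * k)) atTop (nhds 0) := by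
    have h1 : Tendsto (fun M : ℕ => ((1 : ℝ) / 2) ^ M * k⁻¹) atTop (nhds (0 * k⁻¹)) :=
      (tendsto_pow_atTop_nhds_zero_of_lt_one (by norm_num) (by norm_num)).mul_const _
    rw [zero_mul] at h1
    refine h1.congr fun M => ?_
    rw [one_div, one_div, inv_pow, mul_inv]
  have hev := (hlim.eventually (gt_mem_nhds hd))
  filter_upwards [hev] with M hM
  exact coreCutoff_pow_mul_eq_one hk (le_trans hM.le (min_le_left _ _)) (le_trans hM.le (min_le_right _ _))

end Partition

end Literature.Analysis.FluidPDE.TaoY6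

end
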